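import Literature.NumberTheory.EllipticCurves.NewformTraceZetaSymmSquare
import Literature.NumberTheory.EllipticCurves.NewformPeterssonSizeSiegelProofs
import Literature.NumberTheory.LFunctions.ZetaRealAxis
import HarnessLib

/-!
# The Rankin–Selberg continuation of the symmetric square of a newform of squarefree level to
# `Re s > 1/2`, and the Petersson lower bound conditional on its real zeros

Topic `NumberTheory/EllipticCurves`; namespace `Literature.NumberTheory.EllipticCurves.ModularForms`.
Definitions with bodies (`traceZeta`, `symmSqRSFactor`, `symmSqRS`) and theorems; no named fact.

For `f ∈ S₂(Γ₀(N))` let `Z_f(s) = s(s−1)∫_𝒟 G_f E₀*(·,s)dμ + ½∫_𝒟 G_f dμ` be the completed trace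
zeta function of `NewformPeterssonSizeSiegelProofs` (`traceZeta`; entire in `s` by the level-one
Rankin–Selberg theory of the tree) and

  `E_N(s) = s π^{-s}Γ(s)ζ(2s)Γ(s+1)(4π/N)^{-(s+1)} · (N⁻¹Σ_{c∣N} c^{-s}) · L₁(χ₀, s)/L(χ₀, 2s)`

(`symmSqRSFactor`; `L₁(χ₀, s) = (s−1)L(χ₀, s)` Mathlib's entire `LFunctionTrivChar₁`, `χ₀` the
trivial character mod `N`). We DEFINE `symmSqRS f s := Z_f(s)/E_N(s)` and PROVE:

* `IsNewform0.symmSqRS_eq_LSeries_symmSqCoeff` — for squarefree `N`, a newform `f` and `Re s > 1`,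
  **`symmSqRS f s = L^{naive}(Sym² f, s+1)`** (`IsNewform0.traceZeta_eq_symmSq_of_squarefree`): so
  `symmSqRS f` is a continuation of the (shifted) naive symmetric-square series of
  `CuspFormSymmSquareLSeries` — for the newform of a semistable `E/ℚ` the motivic `L(Sym² E, s+1)`
  ([Watkins2004], §1) — to all of `ℂ` as a quotient, holomorphic wherever `E_N ≠ 0`;
* `symmSqRSFactor_ofReal_ne_zero` — **`E_N(σ) ≠ 0` for real `σ > 1/2`** (`ζ(σ) < 0` on `(0,1)`,
  `ZetaRealAxis`; `ζ ≠ 0` on `Re ≥ 1`; `L(χ₀, 2σ) ≠ 0`; `Γ > 0`), hence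
  `traceZeta_ofReal_eq_zero_iff`: **for `σ > 1/2`, `Z_f(σ) = 0 ↔ symmSqRS f σ = 0`**;
* `differentiable_traceZeta` (`Z_f` entire), `differentiableAt_symmSqRSFactor` (`Re s > 1/2`),
  `analyticOnNhd_symmSqRS` — `symmSqRS f` is analytic on the open set `{Re s > 1/2, E_N ≠ 0}`
  (containing `Re s > 1` and the real ray `σ > 1/2`), and `IsNewform0.eqOn_symmSqRS_of_analyticOnNhd`
  — it is THE analytic continuation of `L^{naive}(Sym² f, s+1)` there (identity theorem);
* `IsNewform0.petersson_lower_bound_log_of_symmSqRS_zeroFree` and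
  **`petersson_lower_bound_of_symmSqRS_noExceptionalZero`** — the theorems of
  `NewformPeterssonSizeSiegelProofs` for squarefree `N` with the hypothesis now on the real zeros of
  `symmSqRS f` in `[1 − 1/(A log(N+2)), 1)`: if for some `A > 0` no newform of squarefree level has
  such a zero (the theorem of Goldfeld–Hoffstein–Lieman, appendix to [HoffsteinLockhart1994], for
  `L(s, Sym² f)`; not in the tree), then `Re (f,f) ≥ c_ε N^{1−ε}` for every newform of squarefree
  level — Murty's bound [Murty1999CongruencePrimes, §2] for all semistable elliptic curves.

## References

* [Rankin1939] R. A. Rankin, Proc. Cambridge Philos. Soc. 35 (1939), §4.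
* [HoffsteinLockhart1994] J. Hoffstein, P. Lockhart; appendix by D. Goldfeld, J. Hoffstein,
  D. Lieman, Ann. of Math. 140 (1994), Thm. 0.1 and Appendix.
* [Murty1999CongruencePrimes] M. R. Murty, *Bounds for congruence primes*, §2.
* [Watkins2004] M. Watkins, arXiv:math/0408126, §1.
-/

noncomputable section

namespace Literature.NumberTheory.EllipticCurves.ModularForms

open Literature.NumberTheory.Automorphic Literature.NumberTheory.LFunctions
open _root_.MeasureTheory Set Filter Complex ModularForm CongruenceSubgroup
open UpperHalfPlane hiding I
open scoped Topology MatrixGroups ModularForm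

section Defs

variable {N : ℕ} [NeZero N]

/-- The **completed trace zeta function** `Z_f(s) = s(s−1)∫_𝒟 G_f E₀*(·,s) dμ + ½∫_𝒟 G_f dμ` of
`f ∈ S₂(Γ₀(N))` (`G_f = rsTrace N 2 f` the `SL₂(ℤ)`-trace of `|f|²y²`, `E₀*` the completed
level-one Eisenstein series minus its constant term); the function whose real zeros enter
`IsNewform0.petersson_lower_bound_of_zeroFree`. [cite: Rankin1939, §4.4] -/
def traceZeta (f : CuspForm (Gamma0 N) 2) (s : ℂ) : ℂ :=
  s * (s - 1) * (∫ w in ModularGroup.fd, (rsTrace N 2 f w : ℂ) * completedEisenstein₀ w s) +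
    (((∫ w in ModularGroup.fd, rsTrace N 2 f w : ℝ)) : ℂ) / 2

variable (N) in
/-- The **elementary factor** `E_N(s) = s π^{-s}Γ(s)ζ(2s)Γ(s+1)(4π/N)^{-(s+1)} (N⁻¹Σ_{c∣N}c^{-s})
L₁(χ₀,s)/L(χ₀,2s)` with `L₁(χ₀, s) = (s − 1)L(χ₀, s)` (Mathlib's `LFunctionTrivChar₁`), by which
`Z_f` differs from `L^{naive}(Sym² f, s+1)` for a newform of squarefree level `N`
(`IsNewform0.traceZeta_eq_symmSq_of_squarefree`). [folklore] -/
def symmSqRSFactor (s : ℂ) : ℂ :=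
  s * ((Real.pi : ℂ) ^ (-s) * Complex.Gamma s * riemannZeta (2 * s) *
      (Complex.Gamma (s + 1) * (((4 * Real.pi / N : ℝ)) : ℂ) ^ (-(s + 1)))) *
    (((N : ℂ)⁻¹ * ∑ c ∈ N.divisors, (c : ℂ) ^ (-s)) *
      (DirichletCharacter.LFunctionTrivChar₁ N s / DirichletCharacter.LFunctionTrivChar N (2 * s)))

/-- The **Rankin–Selberg continuation of the symmetric square**: `symmSqRS f s := Z_f(s)/E_N(s)`.
For a newform `f` of squarefree level it equals `L^{naive}(Sym² f, s+1) = Σ symmSqCoeff f n n^{-(s+1)}`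
on `Re s > 1` (`IsNewform0.symmSqRS_eq_LSeries_symmSqCoeff`), and `E_N(σ) ≠ 0` for real
`σ > 1/2`; elsewhere (non-squarefree level, or zeros of `E_N`) the value carries no meaning.
[cite: Rankin1939, §4.4] -/
def symmSqRS (f : CuspForm (Gamma0 N) 2) (s : ℂ) : ℂ :=
  traceZeta f s / symmSqRSFactor N s

omit [NeZero N] in
/-- Unfolding `traceZeta`. [folklore] -/
theorem traceZeta_def (f : CuspForm (Gamma0 N) 2) (s : ℂ) :
    traceZeta f s = s * (s - 1) * (∫ w in ModularGroup.fd, (rsTrace N 2 f w : ℂ) * completedEisenstein₀ w s) +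
      (((∫ w in ModularGroup.fd, rsTrace N 2 f w : ℝ)) : ℂ) / 2 := rfl

/-- Unfolding `symmSqRS`. [folklore] -/
theorem symmSqRS_def (f : CuspForm (Gamma0 N) 2) (s : ℂ) :
    symmSqRS f s = traceZeta f s / symmSqRSFactor N s := rfl

end Defs

section Dictionary

variable {N : ℕ} [NeZero N]

/-- On `Re s > 1`, `L₁(χ₀, s)/L(χ₀, 2s) = (s − 1) L(χ₀, s)/L(χ₀, 2s)` with the `LSeries`. [folklore] -/
theorem LFunctionTrivChar₁_div_eq {s : ℂ} (hs : 1 < s.re) :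
    DirichletCharacter.LFunctionTrivChar₁ N s / DirichletCharacter.LFunctionTrivChar N (2 * s) =
      (s - 1) * LSeries (fun n : ℕ ↦ (1 : DirichletCharacter ℂ N) n) s /
        LSeries (fun n : ℕ ↦ (1 : DirichletCharacter ℂ N) n) (2 * s) := by
  have hs1 : s ≠ 1 := fun h ↦ by rw [h, Complex.one_re] at hs; exact lt_irrefl _ hs
  have h2s : 1 < (2 * s).re := by
    simp only [Complex.mul_re, Complex.re_ofNat, Complex.im_ofNat, zero_mul, sub_zero]; linarith
  have e0 : DirichletCharacter.LFunctionTrivChar₁ N s = (s - 1) * DirichletCharacter.LFunctionTrivChar N s :=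
    Function.update_of_ne hs1 _ _
  have e1 : DirichletCharacter.LFunctionTrivChar N s = LSeries (fun n : ℕ ↦ (1 : DirichletCharacter ℂ N) n) s :=
    DirichletCharacter.LFunction_eq_LSeries _ hs
  have e2 : DirichletCharacter.LFunctionTrivChar N (2 * s) =
      LSeries (fun n : ℕ ↦ (1 : DirichletCharacter ℂ N) n) (2 * s) :=
    DirichletCharacter.LFunction_eq_LSeries _ h2s
  rw [e0, e1, e2]

omit [NeZero N] in
/-- **`Σ_{c ∣ N} c^{-s} = ∏_{p ∣ N}(1 + p^{-s})` for squarefree `N`** (multiplicativity of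
`n ↦ n^{-s}`). [folklore] -/
theorem sum_divisors_cpow_neg_eq_prod (hN : Squarefree N) (s : ℂ) :
    ∑ c ∈ N.divisors, (c : ℂ) ^ (-s) = ∏ p ∈ N.primeFactors, (1 + (p : ℂ) ^ (-s)) := by
  classical
  set g : ArithmeticFunction ℂ := ⟨fun n : ℕ ↦ if n = 0 then 0 else (n : ℂ) ^ (-s), by simp⟩ with hg
  have hg_apply : ∀ {n : ℕ}, n ≠ 0 → g n = (n : ℂ) ^ (-s) := fun {n} hn ↦ by
    simp [hg, ArithmeticFunction.coe_mk, hn]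
  have hmult : g.IsMultiplicative := by
    refine ⟨by rw [hg_apply one_ne_zero]; simp, fun {m n} _ ↦ ?_⟩
    rcases eq_or_ne m 0 with rfl | hm
    · simp [hg]
    rcases eq_or_ne n 0 with rfl | hn
    · simp [hg]
    rw [hg_apply (mul_ne_zero hm hn), hg_apply hm, hg_apply hn, Nat.cast_mul,
      Complex.natCast_mul_natCast_cpow]
  calc ∑ c ∈ N.divisors, (c : ℂ) ^ (-s) = ∑ c ∈ N.divisors, g c :=
        Finset.sum_congr rfl fun c hc ↦ (hg_apply (Nat.pos_of_mem_divisors hc).ne').symm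
    _ = ∏ p ∈ N.primeFactors, (1 + g p) := (hmult.prodPrimeFactors_one_add_of_squarefree hN).symm
    _ = ∏ p ∈ N.primeFactors, (1 + (p : ℂ) ^ (-s)) :=
        Finset.prod_congr rfl fun p hp ↦ by rw [hg_apply (Nat.prime_of_mem_primeFactors hp).ne_zero]

omit [NeZero N] in
/-- `Σ_{c ∣ N} c^{-s} ≠ 0` for squarefree `N` and `Re s > 0` (each factor `1 + p^{-s}` has
`|p^{-s}| < 1`). [folklore] -/
theorem sum_divisors_cpow_neg_ne_zero (hN : Squarefree N) {s : ℂ} (hs : 0 < s.re) :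
    ∑ c ∈ N.divisors, (c : ℂ) ^ (-s) ≠ 0 := by
  rw [sum_divisors_cpow_neg_eq_prod hN]
  refine Finset.prod_ne_zero_iff.mpr fun p hp h ↦ ?_
  have hp1 : 1 < p := (Nat.prime_of_mem_primeFactors hp).one_lt
  have hnorm : ‖(p : ℂ) ^ (-s)‖ < 1 := by
    rw [Complex.norm_natCast_cpow_of_pos (by omega), Complex.neg_re]
    exact Real.rpow_lt_one_of_one_lt_of_neg (by exact_mod_cast hp1) (by linarith)
  have : (p : ℂ) ^ (-s) = -1 := by linear_combination h
  rw [this, norm_neg, norm_one] at hnorm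
  exact lt_irrefl _ hnorm

/-- The Gamma function has no zero of positive real part. [folklore] -/
theorem Gamma_ne_zero_of_re_pos {s : ℂ} (hs : 0 < s.re) : Complex.Gamma s ≠ 0 := by
  refine Complex.Gamma_ne_zero fun m h ↦ ?_
  have := congrArg Complex.re h
  simp only [Complex.neg_re, Complex.natCast_re] at this
  linarith [Nat.cast_nonneg (α := ℝ) m]

/-- **`symmSqRS f s = L^{naive}(Sym² f, s+1)` on `Re s > 1`** for a newform `f` of squarefree level
(`IsNewform0.traceZeta_eq_symmSq_of_squarefree`; all factors of `E_N` are non-zero there).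
[cite: Rankin1939, §4.4] -/
theorem IsNewform0.symmSqRS_eq_LSeries_symmSqCoeff (hN : Squarefree N) {f : CuspForm (Gamma0 N) 2}
    (hf : IsNewform0 f) {s : ℂ} (hs : 1 < s.re) :
    symmSqRS f s = LSeries (symmSqCoeff f) (s + 1) := by
  have hN0 : (N : ℂ) ≠ 0 := by exact_mod_cast (NeZero.ne N)
  have hNr : (0 : ℝ) < N := Nat.cast_pos.mpr (NeZero.pos N)
  have hs0 : s ≠ 0 := fun h ↦ by rw [h, Complex.zero_re] at hs; linarith
  have hs1 : s - 1 ≠ 0 := by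
    intro h
    have : s = 1 := sub_eq_zero.mp h
    rw [this, Complex.one_re] at hs
    exact lt_irrefl _ hs
  have h2s : 1 < (2 * s).re := by
    simp only [Complex.mul_re, Complex.re_ofNat, Complex.im_ofNat, zero_mul, sub_zero]; linarith
  have hπ : (Real.pi : ℂ) ^ (-s) ≠ 0 :=
    Complex.cpow_ne_zero_iff.mpr (Or.inl (by exact_mod_cast Real.pi_pos.ne'))
  have hΓ : Complex.Gamma s ≠ 0 := Gamma_ne_zero_of_re_pos (by linarith)
  have hΓ1 : Complex.Gamma (s + 1) ≠ 0 :=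
    Gamma_ne_zero_of_re_pos (by simp only [Complex.add_re, Complex.one_re]; linarith)
  have hζ : riemannZeta (2 * s) ≠ 0 := riemannZeta_ne_zero_of_one_lt_re h2s
  have ha : (((4 * Real.pi / N : ℝ)) : ℂ) ^ (-(s + 1)) ≠ 0 :=
    Complex.cpow_ne_zero_iff.mpr (Or.inl
      (by exact_mod_cast (by positivity : (0 : ℝ) < 4 * Real.pi / N).ne'))
  have hP : ∑ c ∈ N.divisors, (c : ℂ) ^ (-s) ≠ 0 := sum_divisors_cpow_neg_ne_zero hN (by linarith)
  have hL1 : LSeries (fun n : ℕ ↦ (1 : DirichletCharacter ℂ N) n) s ≠ 0 :=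
    DirichletCharacter.LSeries_ne_zero_of_one_lt_re _ hs
  have hL2 : LSeries (fun n : ℕ ↦ (1 : DirichletCharacter ℂ N) n) (2 * s) ≠ 0 :=
    DirichletCharacter.LSeries_ne_zero_of_one_lt_re _ h2s
  rw [symmSqRS, traceZeta, symmSqRSFactor, hf.traceZeta_eq_symmSq_of_squarefree hN hs,
    LFunctionTrivChar₁_div_eq hs]
  set Z2 := riemannZeta (2 * s)
  set L1 := LSeries (fun n : ℕ ↦ (1 : DirichletCharacter ℂ N) n) s
  set L2 := LSeries (fun n : ℕ ↦ (1 : DirichletCharacter ℂ N) n) (2 * s)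
  set LS := LSeries (symmSqCoeff f) (s + 1)
  set G0 := Complex.Gamma s
  set G1 := Complex.Gamma (s + 1)
  set P0 := (Real.pi : ℂ) ^ (-s)
  set A0 := (((4 * Real.pi / N : ℝ)) : ℂ) ^ (-(s + 1))
  set D0 := ∑ c ∈ N.divisors, (c : ℂ) ^ (-s)
  field_simp

end Dictionary

/-! ### Non-vanishing of `E_N` on the real half-line `σ > 1/2` -/

section RealAxis

variable {N : ℕ} [NeZero N]

/-- `ζ(σ) ≠ 0` for real `σ > 1/2`, `σ ≠ 1`: negative on `(0,1)` (`ZetaRealAxis`), non-zero on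
`Re ≥ 1`. (At `σ = 1` Mathlib's `riemannZeta 1` is a finite junk value.) [folklore] -/
theorem riemannZeta_ofReal_ne_zero_of_half_lt {σ : ℝ} (hσ : 1 / 2 < σ) (hσ1 : σ ≠ 1) :
    riemannZeta σ ≠ 0 := by
  rcases lt_or_gt_of_ne hσ1 with h | h
  · intro h0
    have := riemannZeta_re_neg_of_pos_of_lt_one (by linarith) h
    rw [h0, Complex.zero_re] at this
    exact lt_irrefl _ this
  · exact riemannZeta_ne_zero_of_one_lt_re (by simpa using h)

/-- `L₁(χ₀, σ) ≠ 0` for real `σ > 1/2` (`= (σ−1)∏_{p∣N}(1 − p^{-σ}) ζ(σ)` for `σ ≠ 1`, and the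
patched value `∏(1 − 1/p) ≠ 0` at `σ = 1`). [folklore] -/
theorem LFunctionTrivChar₁_ofReal_ne_zero {σ : ℝ} (hσ : 1 / 2 < σ) :
    DirichletCharacter.LFunctionTrivChar₁ N σ ≠ 0 := by
  by_cases h1 : (σ : ℂ) = 1
  · rw [h1]; exact DirichletCharacter.LFunctionTrivChar₁_apply_one_ne_zero N
  have hσ1 : σ ≠ 1 := fun h ↦ h1 (by rw [h]; simp)
  have e0 : DirichletCharacter.LFunctionTrivChar₁ N σ = ((σ : ℂ) - 1) * DirichletCharacter.LFunctionTrivChar N σ :=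
    Function.update_of_ne h1 _ _
  rw [e0, DirichletCharacter.LFunctionTrivChar_eq_mul_riemannZeta h1]
  refine mul_ne_zero (sub_ne_zero.mpr h1) (mul_ne_zero ?_ (riemannZeta_ofReal_ne_zero_of_half_lt hσ hσ1))
  refine Finset.prod_ne_zero_iff.mpr fun p hp h ↦ ?_
  have hp1 : 1 < p := (Nat.prime_of_mem_primeFactors hp).one_lt
  have hnorm : ‖(p : ℂ) ^ (-(σ : ℂ))‖ < 1 := by
    rw [Complex.norm_natCast_cpow_of_pos (by omega), Complex.neg_re, Complex.ofReal_re]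
    exact Real.rpow_lt_one_of_one_lt_of_neg (by exact_mod_cast hp1) (by linarith)
  have : (p : ℂ) ^ (-(σ : ℂ)) = 1 := by linear_combination -h
  rw [this, norm_one] at hnorm
  exact lt_irrefl _ hnorm

/-- **`E_N(σ) ≠ 0` for real `σ > 1/2`.** [folklore] -/
theorem symmSqRSFactor_ofReal_ne_zero {σ : ℝ} (hσ : 1 / 2 < σ) : symmSqRSFactor N σ ≠ 0 := by
  have hN0 : (N : ℂ) ≠ 0 := by exact_mod_cast (NeZero.ne N)
  have hNr : (0 : ℝ) < N := Nat.cast_pos.mpr (NeZero.pos N)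
  have hσ0 : (σ : ℂ) ≠ 0 := by exact_mod_cast (by linarith : σ ≠ 0)
  have h2σ : 1 < (2 * (σ : ℂ)).re := by simp; linarith
  have hπ : (Real.pi : ℂ) ^ (-(σ : ℂ)) ≠ 0 :=
    Complex.cpow_ne_zero_iff.mpr (Or.inl (by exact_mod_cast Real.pi_pos.ne'))
  have hΓ : Complex.Gamma σ ≠ 0 := Gamma_ne_zero_of_re_pos (by simp; linarith)
  have hΓ1 : Complex.Gamma (σ + 1) ≠ 0 := Gamma_ne_zero_of_re_pos (by simp; linarith)
  have hζ : riemannZeta (2 * (σ : ℂ)) ≠ 0 := riemannZeta_ne_zero_of_one_lt_re h2σ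
  have ha : (((4 * Real.pi / N : ℝ)) : ℂ) ^ (-((σ : ℂ) + 1)) ≠ 0 :=
    Complex.cpow_ne_zero_iff.mpr (Or.inl
      (by exact_mod_cast (by positivity : (0 : ℝ) < 4 * Real.pi / N).ne'))
  have hP : ∑ c ∈ N.divisors, (c : ℂ) ^ (-(σ : ℂ)) ≠ 0 := by
    -- a sum of positive reals
    have : ∑ c ∈ N.divisors, (c : ℂ) ^ (-(σ : ℂ)) = ((∑ c ∈ N.divisors, (c : ℝ) ^ (-σ) : ℝ) : ℂ) := by
      push_cast
      refine Finset.sum_congr rfl fun c _ ↦ ?_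
      rw [Complex.ofReal_cpow (Nat.cast_nonneg c)]
      push_cast
      rfl
    rw [this, Complex.ofReal_ne_zero]
    refine (Finset.sum_pos (fun c hc ↦ Real.rpow_pos_of_pos (Nat.cast_pos.mpr (Nat.pos_of_mem_divisors hc)) _)
      ⟨1, Nat.one_mem_divisors.mpr (NeZero.ne N)⟩).ne'
  have hL1 := LFunctionTrivChar₁_ofReal_ne_zero (N := N) hσ
  have hL2 : DirichletCharacter.LFunctionTrivChar N (2 * (σ : ℂ)) ≠ 0 := by
    have e2 : DirichletCharacter.LFunctionTrivChar N (2 * (σ : ℂ)) =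
        LSeries (fun n : ℕ ↦ (1 : DirichletCharacter ℂ N) n) (2 * (σ : ℂ)) :=
      DirichletCharacter.LFunction_eq_LSeries _ h2σ
    rw [e2]
    exact DirichletCharacter.LSeries_ne_zero_of_one_lt_re _ h2σ
  unfold symmSqRSFactor
  exact mul_ne_zero (mul_ne_zero hσ0 (mul_ne_zero (mul_ne_zero (mul_ne_zero hπ hΓ) hζ) (mul_ne_zero hΓ1 ha)))
    (mul_ne_zero (mul_ne_zero (inv_ne_zero hN0) hP) (div_ne_zero hL1 hL2))

/-- **For real `σ > 1/2`: `Z_f(σ) = 0 ↔ symmSqRS f σ = 0`.** [folklore] -/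
theorem traceZeta_ofReal_eq_zero_iff (f : CuspForm (Gamma0 N) 2) {σ : ℝ} (hσ : 1 / 2 < σ) :
    traceZeta f σ = 0 ↔ symmSqRS f σ = 0 := by
  rw [symmSqRS, div_eq_zero_iff, or_iff_left (symmSqRSFactor_ofReal_ne_zero hσ)]

end RealAxis

/-! ### The Petersson lower bound conditional on the real zeros of `symmSqRS` -/

section Petersson

/-- **Effective form, squarefree level, hypothesis on `symmSqRS`**: there is an absolute `A₀ > 0`
such that for every `A ≥ A₀` there is `c > 0` with: for every squarefree `N` and every newform
`f ∈ S₂(Γ₀(N))` such that `symmSqRS f` (the Rankin–Selberg continuation of `L^{naive}(Sym² f, s+1)`)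
has no real zero `σ` with `1 − 1/(A log(N+2)) ≤ σ < 1`, `c N/log(N+2) ≤ Re (f,f)_{Γ₀(N)}`
(`IsNewform0.petersson_lower_bound_log_of_zeroFree'` and `traceZeta_ofReal_eq_zero_iff`; at
`σ = 1`, `Z_f(1) = ½ Re (f,f) > 0`). [cite: HoffsteinLockhart1994, Thm. 0.1 and Appendix] -/
theorem IsNewform0.petersson_lower_bound_log_of_symmSqRS_zeroFree :
    ∃ A₀ : ℝ, 0 < A₀ ∧ ∀ A : ℝ, A₀ ≤ A → ∃ c : ℝ, 0 < c ∧
      ∀ (N : ℕ) [NeZero N], Squarefree N → ∀ (f : CuspForm (Gamma0 N) 2), IsNewform0 f →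
        (∀ σ : ℝ, 1 - 1 / (A * Real.log (N + 2)) ≤ σ → σ < 1 → symmSqRS f σ ≠ 0) →
        c * N / Real.log (N + 2) ≤ (peterssonProduct (Gamma0 N) 2 f f).re := by
  obtain ⟨A₀, hA₀, hmain⟩ := IsNewform0.petersson_lower_bound_log_of_zeroFree'
  have hlog2 : (1 : ℝ) / 2 < Real.log 2 := by
    have := Real.log_two_gt_d9; linarith
  refine ⟨max A₀ 4, lt_max_of_lt_left hA₀, fun A hA ↦ ?_⟩
  obtain ⟨c, hc, hcN⟩ := hmain A (le_trans (le_max_left _ _) hA)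
  refine ⟨c, hc, fun N _ hN f hf hZ ↦ hcN N f hf fun σ h1σ h2σ ↦ ?_⟩
  have hA4 : (4 : ℝ) ≤ A := le_trans (le_max_right _ _) hA
  have hN0 : (0 : ℝ) < N := Nat.cast_pos.mpr (NeZero.pos N)
  have hlogN : Real.log 2 ≤ Real.log (N + 2) := Real.log_le_log (by norm_num) (by linarith)
  -- the interval lies inside `(1/2, 1]`
  have hσhalf : 1 / 2 < σ := by
    have h2 : 2 < A * Real.log (N + 2) := by
      have := mul_le_mul hA4 hlogN (Real.log_pos one_lt_two).le (by linarith)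
      linarith
    have : 1 / (A * Real.log (N + 2)) < 1 / 2 := one_div_lt_one_div_of_lt (by norm_num) h2
    linarith
  rcases h2σ.lt_or_eq with hlt | heq
  · -- `σ < 1`: the hypothesis on `symmSqRS`
    have h := hZ σ h1σ hlt
    rw [Ne, ← traceZeta_ofReal_eq_zero_iff f hσhalf, traceZeta] at h
    exact h
  · -- `σ = 1`: `Z_f(1) = ½ Re (f,f) ≠ 0`
    subst heq
    have hV : (0 : ℝ) < ∫ w in ModularGroup.fd, rsTrace N 2 f w := by
      rw [← peterssonProduct_self_re_eq_integral_rsTrace f]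
      have h := normSq_cuspCoeff_mul_le_peterssonProduct_re f one_pos
      rw [show cuspCoeff f 1 = 1 from hf.2.2] at h
      have : (0 : ℝ) < ‖(1 : ℂ)‖ ^ 2 * (Real.exp (-(4 * Real.pi * (1 : ℕ))) / (4 * Real.pi * (1 : ℕ))) := by
        simp only [norm_one, one_pow, one_mul, Nat.cast_one, mul_one]
        positivity
      linarith
    push_cast
    rw [sub_self, mul_zero, zero_mul, zero_add]
    exact div_ne_zero (by exact_mod_cast hV.ne') two_ne_zero

/-- **Murty's bound for all newforms of squarefree level, conditionally on the absence of an
exceptional real zero of `symmSqRS`** (the Goldfeld–Hoffstein–Lieman theorem for `L(s, Sym² f)`,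
not in the tree): if for some `A > 0` no newform `f` of squarefree level `N` has `symmSqRS f σ = 0`
for `1 − 1/(A log(N+2)) ≤ σ < 1`, then for every `ε > 0` there is `c > 0` with
`c N^{1−ε} ≤ Re (f,f)_{Γ₀(N)}` for every newform `f` of squarefree level `N` — in particular for
the newform of every semistable elliptic curve over `ℚ`.
[cite: Murty1999CongruencePrimes, §2; HoffsteinLockhart1994, Thm. 0.1 and Appendix] -/
theorem petersson_lower_bound_of_symmSqRS_noExceptionalZero
    (h : ∃ A : ℝ, 0 < A ∧ ∀ (N : ℕ) [NeZero N], Squarefree N → ∀ (f : CuspForm (Gamma0 N) 2),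
      IsNewform0 f → ∀ σ : ℝ, 1 - 1 / (A * Real.log (N + 2)) ≤ σ → σ < 1 → symmSqRS f σ ≠ 0)
    {ε : ℝ} (hε : 0 < ε) :
    ∃ c : ℝ, 0 < c ∧ ∀ (N : ℕ) [NeZero N], Squarefree N → ∀ (f : CuspForm (Gamma0 N) 2),
      IsNewform0 f → c * (N : ℝ) ^ (1 - ε) ≤ (peterssonProduct (Gamma0 N) 2 f f).re := by
  obtain ⟨A, hA, hZ⟩ := h
  obtain ⟨A₀, hA₀, h1⟩ := IsNewform0.petersson_lower_bound_log_of_symmSqRS_zeroFree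
  obtain ⟨c, hc, hcN⟩ := h1 (max A A₀) (le_max_right _ _)
  have h3ε : (0 : ℝ) < (3 : ℝ) ^ ε := Real.rpow_pos_of_pos (by norm_num) _
  refine ⟨c * ε / (3 : ℝ) ^ ε, by positivity, fun N _ hN f hf ↦ ?_⟩
  have hN0 : (0 : ℝ) < N := Nat.cast_pos.mpr (NeZero.pos N)
  have hN1 : (1 : ℝ) ≤ N := by exact_mod_cast NeZero.one_le
  have hlogN0 : 0 < Real.log (N + 2) := Real.log_pos (by linarith)
  have hZ' : ∀ σ : ℝ, 1 - 1 / (max A A₀ * Real.log (N + 2)) ≤ σ → σ < 1 → symmSqRS f σ ≠ 0 := by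
    intro σ h1σ h2σ
    refine hZ N hN f hf σ (le_trans ?_ h1σ) h2σ
    have : 1 / (max A A₀ * Real.log (N + 2)) ≤ 1 / (A * Real.log (N + 2)) := by
      apply one_div_le_one_div_of_le (by positivity)
      exact mul_le_mul_of_nonneg_right (le_max_left _ _) hlogN0.le
    linarith
  have hmain := hcN N hN f hf hZ'
  have hlog : Real.log (N + 2) ≤ (3 : ℝ) ^ ε * (N : ℝ) ^ ε / ε := by
    have h1 : Real.log ((N : ℝ) + 2) ≤ ((N : ℝ) + 2) ^ ε / ε := Real.log_le_rpow_div (by positivity) hε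
    have h2 : ((N : ℝ) + 2) ^ ε ≤ (3 * (N : ℝ)) ^ ε :=
      Real.rpow_le_rpow (by linarith) (by linarith) hε.le
    rw [Real.mul_rpow (by norm_num) hN0.le] at h2
    calc Real.log ((N : ℝ) + 2) ≤ ((N : ℝ) + 2) ^ ε / ε := h1
      _ ≤ (3 : ℝ) ^ ε * (N : ℝ) ^ ε / ε := by gcongr
  calc c * ε / (3 : ℝ) ^ ε * (N : ℝ) ^ (1 - ε)
      = c * N / ((3 : ℝ) ^ ε * (N : ℝ) ^ ε / ε) := by
        rw [Real.rpow_sub hN0, Real.rpow_one]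
        field_simp
    _ ≤ c * N / Real.log (N + 2) := by
        apply div_le_div_of_nonneg_left (by positivity) hlogN0 hlog
    _ ≤ (peterssonProduct (Gamma0 N) 2 f f).re := hmain

end Petersson


/-! ### Analyticity of `symmSqRS` on `Re s > 1/2` away from the zeros of `E_N` -/

section Analytic

variable {N : ℕ} [NeZero N]

/-- **`Z_f` is entire** (`differentiable_J₀` for the `SL₂(ℤ)`-trace datum of `f`).
[cite: Rankin1939, §4.4] -/
theorem differentiable_traceZeta (f : CuspForm (Gamma0 N) 2) : Differentiable ℂ (traceZeta f) := by
  have hGc : Continuous (rsTrace N 2 f) := continuous_rsTrace (ModularFormClass.continuous f)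
  have hGinv : ∀ (A : SL(2, ℤ)) (τ : ℍ), rsTrace N 2 f (A • τ) = rsTrace N 2 f τ :=
    fun A τ ↦ rsTrace_smul f A τ
  have hG0 : ∀ τ, 0 ≤ rsTrace N 2 f τ := fun τ ↦ rsTrace_nonneg _ τ
  obtain ⟨B, -, hB⟩ := exists_rsTrace_le f
  have hC : ∀ n, 0 ≤ rsCoeff N 2 f n := fun n ↦ rsCoeff_nonneg _ n
  have hC0 : rsCoeff N 2 f 0 = 0 := rsCoeff_zero f
  have ha : 0 < 4 * Real.pi / (N : ℝ) := by
    have hN0 : (0 : ℝ) < N := Nat.cast_pos.mpr (NeZero.pos N)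
    positivity
  have hs : ∀ y : ℝ, 0 < y → Summable fun n : ℕ ↦ rsCoeff N 2 f n * Real.exp (-(4 * Real.pi / N) * n * y) :=
    fun y hy ↦ summable_rsCoeff_mul_exp_datum f hy
  have hm : ∀ y : ℝ, 0 < y → ∫ x in (0 : ℝ)..1, rsTrace N 2 f (pt x y) =
      y ^ (2 : ℝ) * ∑' n : ℕ, rsCoeff N 2 f n * Real.exp (-(4 * Real.pi / N) * n * y) :=
    fun y hy ↦ horocycle_rsTrace_datum f hy
  have hκ : (0 : ℝ) ≤ 2 := by norm_num
  have hJ := differentiable_J₀ hGc hGinv hG0 hB hC hC0 ha hκ hs hm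
  show Differentiable ℂ fun s : ℂ ↦ s * (s - 1) *
      (∫ w in ModularGroup.fd, (rsTrace N 2 f w : ℂ) * completedEisenstein₀ w s) +
    (((∫ w in ModularGroup.fd, rsTrace N 2 f w : ℝ)) : ℂ) / 2
  exact ((differentiable_id.mul (differentiable_id.sub_const 1)).mul hJ).add_const _

/-- **`E_N` is holomorphic on `Re s > 1/2`** (Gamma away from its poles, `ζ(2s)` and `L(χ₀, 2s)` for
`Re 2s > 1`, Mathlib's entire `L₁(χ₀, ·)`, and `c^{-s}`). [folklore] -/
theorem differentiableAt_symmSqRSFactor {s : ℂ} (hs : 1 / 2 < s.re) :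
    DifferentiableAt ℂ (symmSqRSFactor N) s := by
  have hN0 : (N : ℂ) ≠ 0 := by exact_mod_cast (NeZero.ne N)
  have hNr : (0 : ℝ) < N := Nat.cast_pos.mpr (NeZero.pos N)
  have h2s : 1 < (2 * s).re := by
    simp only [Complex.mul_re, Complex.re_ofNat, Complex.im_ofNat, zero_mul, sub_zero]; linarith
  have h2s1 : 2 * s ≠ 1 := fun h ↦ by
    have := congrArg Complex.re h
    rw [Complex.one_re] at this
    linarith
  have hGam : ∀ {z : ℂ}, 0 < z.re → DifferentiableAt ℂ Complex.Gamma z := fun {z} hz ↦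
    Complex.differentiableAt_Gamma z fun m h ↦ by
      have := congrArg Complex.re h
      simp only [Complex.neg_re, Complex.natCast_re] at this
      linarith [Nat.cast_nonneg (α := ℝ) m]
  have d1 : DifferentiableAt ℂ (fun z : ℂ ↦ (Real.pi : ℂ) ^ (-z)) s :=
    differentiableAt_id.neg.const_cpow (Or.inl (by exact_mod_cast Real.pi_pos.ne'))
  have d2 : DifferentiableAt ℂ Complex.Gamma s := hGam (by linarith)
  have d3 : DifferentiableAt ℂ (fun z : ℂ ↦ riemannZeta (2 * z)) s :=
    (differentiableAt_riemannZeta h2s1).comp s (differentiableAt_id.const_mul _)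
  have d4 : DifferentiableAt ℂ (fun z : ℂ ↦ Complex.Gamma (z + 1)) s :=
    (hGam (by simp only [Complex.add_re, Complex.one_re]; linarith)).comp s
      (differentiableAt_id.add_const 1)
  have d5 : DifferentiableAt ℂ (fun z : ℂ ↦ (((4 * Real.pi / N : ℝ)) : ℂ) ^ (-(z + 1))) s :=
    (differentiableAt_id.add_const 1).neg.const_cpow
      (Or.inl (by exact_mod_cast (by positivity : (0 : ℝ) < 4 * Real.pi / N).ne'))
  have d6 : DifferentiableAt ℂ (fun z : ℂ ↦ (N : ℂ)⁻¹ * ∑ c ∈ N.divisors, (c : ℂ) ^ (-z)) s := by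
    refine DifferentiableAt.const_mul (DifferentiableAt.fun_sum fun c hc ↦ ?_) _
    exact differentiableAt_id.neg.const_cpow
      (Or.inl (by exact_mod_cast (Nat.pos_of_mem_divisors hc).ne'))
  have d7 : DifferentiableAt ℂ (DirichletCharacter.LFunctionTrivChar₁ N) s :=
    (DirichletCharacter.differentiable_LFunctionTrivChar₁ N).differentiableAt
  have d8 : DifferentiableAt ℂ (fun z : ℂ ↦ DirichletCharacter.LFunctionTrivChar N (2 * z)) s :=
    (DirichletCharacter.differentiableAt_LFunction _ (2 * s) (Or.inl h2s1)).comp s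
      (differentiableAt_id.const_mul _)
  have hL2 : DirichletCharacter.LFunctionTrivChar N (2 * s) ≠ 0 := by
    have e2 : DirichletCharacter.LFunctionTrivChar N (2 * s) =
        LSeries (fun n : ℕ ↦ (1 : DirichletCharacter ℂ N) n) (2 * s) :=
      DirichletCharacter.LFunction_eq_LSeries _ h2s
    rw [e2]
    exact DirichletCharacter.LSeries_ne_zero_of_one_lt_re _ h2s
  show DifferentiableAt ℂ (fun z : ℂ ↦ z * ((Real.pi : ℂ) ^ (-z) * Complex.Gamma z * riemannZeta (2 * z) *
      (Complex.Gamma (z + 1) * (((4 * Real.pi / N : ℝ)) : ℂ) ^ (-(z + 1)))) *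
    (((N : ℂ)⁻¹ * ∑ c ∈ N.divisors, (c : ℂ) ^ (-z)) *
      (DirichletCharacter.LFunctionTrivChar₁ N z / DirichletCharacter.LFunctionTrivChar N (2 * z)))) s
  exact (differentiableAt_id.mul (((d1.mul d2).mul d3).mul (d4.mul d5))).mul (d6.mul (d7.div d8 hL2))

/-- **`symmSqRS f` is holomorphic at every `s` with `Re s > 1/2` and `E_N(s) ≠ 0`** — in particular
along the whole real ray `σ > 1/2` (`symmSqRSFactor_ofReal_ne_zero`). [folklore] -/
theorem differentiableAt_symmSqRS (f : CuspForm (Gamma0 N) 2) {s : ℂ} (hs : 1 / 2 < s.re)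
    (hE : symmSqRSFactor N s ≠ 0) : DifferentiableAt ℂ (symmSqRS f) s := by
  show DifferentiableAt ℂ (fun z : ℂ ↦ traceZeta f z / symmSqRSFactor N z) s
  exact ((differentiable_traceZeta f).differentiableAt).div (differentiableAt_symmSqRSFactor hs) hE

/-- The domain `{Re s > 1/2, E_N(s) ≠ 0}` is open. [folklore] -/
theorem isOpen_symmSqRS_domain :
    IsOpen {s : ℂ | 1 / 2 < s.re ∧ symmSqRSFactor N s ≠ 0} := by
  have h1 : IsOpen {s : ℂ | 1 / 2 < s.re} := isOpen_lt continuous_const Complex.continuous_re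
  have hc : ContinuousOn (symmSqRSFactor N) {s : ℂ | 1 / 2 < s.re} :=
    fun s hs ↦ (differentiableAt_symmSqRSFactor hs).continuousAt.continuousWithinAt
  have := hc.isOpen_inter_preimage h1 isOpen_compl_singleton (t := ({0} : Set ℂ)ᶜ)
  convert this using 1
  ext s
  simp

/-- **`symmSqRS f` is analytic on the open set `{Re s > 1/2, E_N(s) ≠ 0}`**, which contains the
half-plane `Re s > 1` (where it is `L^{naive}(Sym² f, s+1)` for a newform of squarefree level)
and the real ray `σ > 1/2`. [folklore] -/
theorem analyticOnNhd_symmSqRS (f : CuspForm (Gamma0 N) 2) :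
    AnalyticOnNhd ℂ (symmSqRS f) {s : ℂ | 1 / 2 < s.re ∧ symmSqRSFactor N s ≠ 0} := by
  have hd : DifferentiableOn ℂ (symmSqRS f) {s : ℂ | 1 / 2 < s.re ∧ symmSqRSFactor N s ≠ 0} :=
    fun s hs ↦ (differentiableAt_symmSqRS f hs.1 hs.2).differentiableWithinAt
  exact hd.analyticOnNhd isOpen_symmSqRS_domain

/-- The real ray `σ > 1/2` lies in the domain of analyticity. [folklore] -/
theorem ofReal_mem_symmSqRS_domain {σ : ℝ} (hσ : 1 / 2 < σ) :
    (σ : ℂ) ∈ {s : ℂ | 1 / 2 < s.re ∧ symmSqRSFactor N s ≠ 0} :=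
  ⟨by simpa using hσ, symmSqRSFactor_ofReal_ne_zero hσ⟩

/-- **`symmSqRS f` is THE analytic continuation of `L^{naive}(Sym² f, s+1)`** (newform of
squarefree level): any function analytic on an open preconnected `U ⊆ {Re s > 1/2, E_N ≠ 0}`
meeting the half-plane `Re s > 1`, and equal to `Σ symmSqCoeff f n · n^{-(s+1)}` there, coincides
with `symmSqRS f` on `U` (identity theorem). [folklore] -/
theorem IsNewform0.eqOn_symmSqRS_of_analyticOnNhd (hN : Squarefree N) {f : CuspForm (Gamma0 N) 2}
    (hf : IsNewform0 f) {U : Set ℂ} (hUo : IsOpen U) (hUc : IsPreconnected U)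
    (hUsub : U ⊆ {s : ℂ | 1 / 2 < s.re ∧ symmSqRSFactor N s ≠ 0}) {z₀ : ℂ} (hz₀ : z₀ ∈ U)
    (hz₀re : 1 < z₀.re) {G : ℂ → ℂ} (hG : AnalyticOnNhd ℂ G U)
    (hGeq : ∀ s ∈ U, 1 < s.re → G s = LSeries (symmSqCoeff f) (s + 1)) :
    Set.EqOn G (symmSqRS f) U := by
  refine hG.eqOn_of_preconnected_of_eventuallyEq ((analyticOnNhd_symmSqRS f).mono hUsub) hUc hz₀ ?_
  have hV : U ∩ {s : ℂ | 1 < s.re} ∈ nhds z₀ :=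
    (hUo.inter (isOpen_lt continuous_const Complex.continuous_re)).mem_nhds ⟨hz₀, hz₀re⟩
  filter_upwards [hV] with s hs
  rw [hGeq s hs.1 hs.2, hf.symmSqRS_eq_LSeries_symmSqCoeff hN hs.2]

end Analytic

end Literature.NumberTheory.EllipticCurves.ModularForms

end
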